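import Mathlib
import HarnessLib
import Literature.MathematicalPhysics.QuantumLattice.FinDimSpectrumSectorGibbsLimit
import Summits.HubbardSuperconductivity.HubbardSuperconductivity.Theorems.FunctionFieldCertificateWindowInfraredBoundEngineB

/-!
# Crux `WindowInfraredBound` (stmt-HubbardSuperconductivity-1089), line `pair-gaussian-domination-energy-form`:
# stub FV `stub_pgdFirstVariation` — the first-order variation of the energy-form Gaussian domination

Let `H = hubbardTorus 2 L 1 U`, `N̂ = totalNumber`, `Δ = pairFieldAt dWaveFormFactor L m`,
`E(M) = H.minEnergyOn (szSector M 0)`, and let `ψ` be a normalised ground state of `H` in the joint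
sector `(N, S^z = 0)`, `N ≥ 2`. The ENERGY-form (one-sided, `λ`-regularised) Gaussian domination
C⁺_λ of the line says that for every real source amplitude `t`

  `E(N) − μN − X t² ≤ minEnergyOn (H − μ N̂ − t (Δ + Δᴴ)) ((N−2, 0) ⊔ (N, 0))`,
  `2μ = E(N) − E(N−2) + λ`.

**This file** proves the first-order variation of that bound (`stub_pgdFirstVariation`): testing the
Rayleigh quotient of `M_t = H − μ N̂ − t (Δ + Δᴴ)` at `φ_t = ψ + t • w`, `w ∈ (N−2, 0)`, gives

  `⟨φ_t, M_t φ_t⟩ = (E(N) − μN) + t² (Re⟨w, H w⟩ − μ (N−2) ‖w‖² − 2 Re⟨w, Δψ⟩)`,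
  `‖φ_t‖² = 1 + t² ‖w‖²`,

because every cross term vanishes by particle-number orthogonality of distinct `szSector`s
(`⟨ψ, w⟩ = 0`, `⟨ψ, (H − μN̂) w⟩ = (E(N) − μN)⟨ψ, w⟩ = 0`, `⟨ψ, Δψ⟩ = ⟨ψ, Δᴴψ⟩ = 0`,
`⟨w, Δ w⟩ = ⟨Δᴴ w, w⟩ = 0`, `⟨w, Δᴴψ⟩ = 0`; the surviving source terms are
`⟨w, Δψ⟩ + ⟨ψ, Δᴴ w⟩ = 2 Re⟨w, Δψ⟩`). Comparing with C⁺_λ, multiplying out by `‖φ_t‖² > 0`, dividing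
by `t² > 0` and letting `t → 0` yields the `λ`-regularised variational pair stiffness

  `2 Re⟨w, Δψ⟩ − (Re⟨w, H w⟩ − (E(N−2) − λ) ‖w‖²) ≤ X`     (since `E(N) − 2μ = E(N−2) − λ`),

and the twin statement on `(N, 0) ⊔ (N+2, 0)` with `Δᴴψ`, `2μ' = E(N+2) − E(N) − λ`, `w ∈ (N+2, 0)`.
Both are instances of ONE abstract lemma (`pgdfv_firstVariation`) about a Hermitian `A` with
`Aψ = eψ`, a Hermitian source `B` with vanishing diagonal terms, and a subspace `K ∋ ψ, w`.

Sources: T. Kennedy, E. H. Lieb, B. S. Shastry, PRL 61 (1988) 2582 and J. Stat. Phys. 53 (1988) 1019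
(Gaussian domination ⇒ susceptibility / infrared bound, ground-state version); F. J. Dyson, E. H. Lieb,
B. Simon, J. Stat. Phys. 18 (1978) 335, Thm 4.2; first-order (Rayleigh–Schrödinger / Kato) perturbation
of a variational bound. Everything here is folklore finite-dimensional linear algebra over the tree's
definitions; no definition and no named fact is introduced.
-/

namespace Summit.HubbardSuperconductivity.HubbardSuperconductivity.Theorems.WindowInfraredBound

-- summit = problem name (single-conjunct summit, D-0017): `HubbardSuperconductivity` occurs twice in the path
set_option linter.dupNamespace false

open Literature.MathematicalPhysics.QuantumLattice Literature.Probability.LatticeModels Matrix Finset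
open scoped ComplexOrder ComplexConjugate

/-! ## §1 Abstract first variation of a sourced Rayleigh bound -/

section Abstract

variable {n : Type*} [Fintype n]

/-- `‖ψ + t w‖²` expanded for real `t`:
`⟨ψ + t w, ψ + t w⟩ = ⟨ψ,ψ⟩ + t(⟨ψ,w⟩ + ⟨w,ψ⟩) + t²⟨w,w⟩`. [folklore] -/
theorem pgdfv_star_add_smul_dotProduct (ψ w : n → ℂ) (t : ℝ) :
    star (ψ + (t : ℂ) • w) ⬝ᵥ (ψ + (t : ℂ) • w) =
      star ψ ⬝ᵥ ψ + (t : ℂ) * (star ψ ⬝ᵥ w + star w ⬝ᵥ ψ) + ((t ^ 2 : ℝ) : ℂ) * (star w ⬝ᵥ w) := by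
  simp only [star_add, star_smul, add_dotProduct, dotProduct_add, smul_dotProduct, dotProduct_smul,
    smul_eq_mul, Complex.star_def, Complex.conj_ofReal]
  push_cast
  ring

/-- The sourced form `⟨ψ + t w, (A − t B)(ψ + t w)⟩` expanded for real `t` and sorted by powers
of `t`. [folklore] -/
theorem pgdfv_star_add_smul_dotProduct_mulVec (A B : Matrix n n ℂ) (ψ w : n → ℂ) (t : ℝ) :
    star (ψ + (t : ℂ) • w) ⬝ᵥ ((A - (t : ℂ) • B) *ᵥ (ψ + (t : ℂ) • w)) =
      star ψ ⬝ᵥ (A *ᵥ ψ) +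
        (t : ℂ) * (star ψ ⬝ᵥ (A *ᵥ w) + star w ⬝ᵥ (A *ᵥ ψ) - star ψ ⬝ᵥ (B *ᵥ ψ)) +
        ((t ^ 2 : ℝ) : ℂ) * (star w ⬝ᵥ (A *ᵥ w) - star ψ ⬝ᵥ (B *ᵥ w) - star w ⬝ᵥ (B *ᵥ ψ)) -
        ((t ^ 3 : ℝ) : ℂ) * (star w ⬝ᵥ (B *ᵥ w)) := by
  simp only [sub_mulVec, smul_mulVec, mulVec_add, mulVec_smul, star_add, star_smul, smul_sub,
    add_dotProduct, dotProduct_add, dotProduct_sub, smul_dotProduct, dotProduct_smul, smul_eq_mul,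
    Complex.star_def, Complex.conj_ofReal]
  push_cast
  ring

/-- `Re ⟨c u, c v⟩ = ‖c‖² Re ⟨u, v⟩`. [folklore] -/
theorem pgdfv_re_star_smul_dotProduct_smul (c : ℂ) (u v : n → ℂ) :
    (star (c • u) ⬝ᵥ (c • v)).re = ‖c‖ ^ 2 * (star u ⬝ᵥ v).re := by
  rw [star_smul, smul_dotProduct, dotProduct_smul, smul_smul, smul_eq_mul, Complex.star_def,
    Complex.conj_mul', ← Complex.ofReal_pow, Complex.re_ofReal_mul]

/-- **The scalar endgame (`t → 0`).** If `(e − X t²)(1 + t² nw) ≤ e + t² a` for every real `t`,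
then `e·nw − X ≤ a`: for `t ≠ 0` the hypothesis reads `t² (e·nw − X − X t² nw) ≤ t² a`; divide by
`t² > 0` and let `t → 0` along the punctured neighbourhood filter `𝓝[≠] 0`. [folklore] -/
theorem pgdfv_real_endgame {e X nw a : ℝ}
    (h : ∀ t : ℝ, (e - X * t ^ 2) * (1 + t ^ 2 * nw) ≤ e + t ^ 2 * a) : e * nw - X ≤ a := by
  have h' : ∀ t : ℝ, t ≠ 0 → e * nw - X - X * t ^ 2 * nw ≤ a := by
    intro t ht
    have ht2 : 0 < t ^ 2 := by positivity
    refine le_of_mul_le_mul_left ?_ ht2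
    have e1 : (e - X * t ^ 2) * (1 + t ^ 2 * nw) = e + t ^ 2 * (e * nw - X - X * t ^ 2 * nw) := by
      ring
    linarith [h t, e1]
  have hcont : Filter.Tendsto (fun t : ℝ => e * nw - X - X * t ^ 2 * nw) (nhdsWithin (0 : ℝ) {0}ᶜ)
      (nhds (e * nw - X - X * (0 : ℝ) ^ 2 * nw)) :=
    ((by fun_prop : Continuous fun t : ℝ => e * nw - X - X * t ^ 2 * nw).tendsto 0).mono_left
      nhdsWithin_le_nhds
  have hle := le_of_tendsto hcont (eventually_nhdsWithin_of_forall h')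
  simpa using hle

variable [DecidableEq n]

/-- **Abstract first variation of a sourced Rayleigh lower bound.** Let `A`, `B` be Hermitian,
`K` a subspace, `ψ, w ∈ K` with `‖ψ‖ = 1`, `Aψ = eψ`, `⟨ψ, w⟩ = 0`, `⟨ψ, Bψ⟩ = 0`, `⟨w, Bw⟩ = 0`.
If `e − X t² ≤ minEnergyOn (A − tB) K` for every real `t`, then
`2 Re⟨w, Bψ⟩ − (Re⟨w, A w⟩ − e ‖w‖²) ≤ X`. Proof: the Rayleigh quotient of `A − tB` at `ψ + t w` is
`(e + t² (Re⟨w,Aw⟩ − 2Re⟨w,Bψ⟩)) / (1 + t² ‖w‖²)` (all cross terms vanish: `⟨ψ, A w⟩ = e⟨ψ, w⟩ = 0`,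
`⟨ψ, B w⟩ = conj ⟨w, B ψ⟩`), it dominates `minEnergyOn`, and `t → 0` (`pgdfv_real_endgame`).
Kennedy–Lieb–Shastry (1988) (Gaussian domination ⇒ susceptibility bound); first-order perturbation
theory. [folklore] -/
theorem pgdfv_firstVariation {A B : Matrix n n ℂ} (hA : A.IsHermitian) (hB : B.IsHermitian)
    (K : Submodule ℂ (n → ℂ)) {ψ w : n → ℂ} (hψK : ψ ∈ K) (hwK : w ∈ K) (hψ1 : star ψ ⬝ᵥ ψ = 1)
    {e X : ℝ} (hAψ : A *ᵥ ψ = (e : ℂ) • ψ) (horth : star ψ ⬝ᵥ w = 0)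
    (hψB : star ψ ⬝ᵥ (B *ᵥ ψ) = 0) (hwB : star w ⬝ᵥ (B *ᵥ w) = 0)
    (hGD : ∀ t : ℝ, e - X * t ^ 2 ≤ (A - (t : ℂ) • B).minEnergyOn K) :
    2 * (star w ⬝ᵥ (B *ᵥ ψ)).re - ((star w ⬝ᵥ (A *ᵥ w)).re - e * (star w ⬝ᵥ w).re) ≤ X := by
  have hnw : 0 ≤ (star w ⬝ᵥ w).re := (Complex.nonneg_iff.1 (dotProduct_star_self_nonneg w)).1
  -- the vanishing / conjugate cross terms
  have horth' : star w ⬝ᵥ ψ = 0 := by rw [star_dotProduct, horth, star_zero]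
  have hψAψ : star ψ ⬝ᵥ (A *ᵥ ψ) = (e : ℂ) := by
    rw [hAψ, dotProduct_smul, hψ1, smul_eq_mul, mul_one]
  have hψAw : star ψ ⬝ᵥ (A *ᵥ w) = 0 := by
    rw [WcbcsSsbToTorusLRO.mc_star_dotProduct_mulVec_eq A ψ w, hA.eq, hAψ, star_smul,
      smul_dotProduct, horth, smul_zero]
  have hwAψ : star w ⬝ᵥ (A *ᵥ ψ) = 0 := by rw [hAψ, dotProduct_smul, horth', smul_zero]
  have hψBw : star ψ ⬝ᵥ (B *ᵥ w) = star (star w ⬝ᵥ (B *ᵥ ψ)) := by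
    rw [WcbcsSsbToTorusLRO.mc_star_dotProduct_mulVec_eq B w ψ, hB.eq, star_dotProduct]
  -- `A - tB` is Hermitian
  have hM : ∀ t : ℝ, (A - (t : ℂ) • B).IsHermitian := fun t => by
    refine hA.sub ?_
    rw [IsHermitian, conjTranspose_smul, hB.eq, Complex.star_def, Complex.conj_ofReal]
  -- the Rayleigh test at `ψ + t • w`, multiplied out
  have key : ∀ t : ℝ, (e - X * t ^ 2) * (1 + t ^ 2 * (star w ⬝ᵥ w).re) ≤
      e + t ^ 2 * ((star w ⬝ᵥ (A *ᵥ w)).re - 2 * (star w ⬝ᵥ (B *ᵥ ψ)).re) := by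
    intro t
    -- norm and Rayleigh numerator of `φ = ψ + t • w`
    have hnorm : (star (ψ + (t : ℂ) • w) ⬝ᵥ (ψ + (t : ℂ) • w)).re = 1 + t ^ 2 * (star w ⬝ᵥ w).re := by
      rw [pgdfv_star_add_smul_dotProduct, hψ1, horth, horth', add_zero, mul_zero, add_zero]
      simp only [Complex.add_re, Complex.one_re, Complex.re_ofReal_mul]
    have hray : (star (ψ + (t : ℂ) • w) ⬝ᵥ ((A - (t : ℂ) • B) *ᵥ (ψ + (t : ℂ) • w))).re =
        e + t ^ 2 * ((star w ⬝ᵥ (A *ᵥ w)).re - 2 * (star w ⬝ᵥ (B *ᵥ ψ)).re) := by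
      rw [pgdfv_star_add_smul_dotProduct_mulVec, hψAψ, hψAw, hwAψ, hψB, hwB, hψBw]
      simp only [add_zero, sub_zero, mul_zero, Complex.add_re, Complex.sub_re, Complex.ofReal_re,
        Complex.re_ofReal_mul, Complex.star_def, Complex.conj_re]
      ring
    -- `φ ≠ 0` (its norm is `≥ 1`); normalise it inside `K`
    have hpos : 0 < 1 + t ^ 2 * (star w ⬝ᵥ w).re := by positivity
    have hφ0 : ψ + (t : ℂ) • w ≠ 0 := by
      intro h0
      rw [h0, star_zero, zero_dotProduct, Complex.zero_re] at hnorm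
      exact absurd hnorm hpos.ne
    have hφK : ψ + (t : ℂ) • w ∈ K := K.add_mem hψK (K.smul_mem _ hwK)
    obtain ⟨c, -, hc1⟩ := exists_smul_unit hφ0
    have hc2 : ‖c‖ ^ 2 * (1 + t ^ 2 * (star w ⬝ᵥ w).re) = 1 := by
      have h1 := congrArg Complex.re hc1
      rwa [pgdfv_re_star_smul_dotProduct_smul, hnorm, Complex.one_re] at h1
    -- `minEnergyOn ≤` Rayleigh quotient of the unit vector `c • φ`
    have hle := minEnergyOn_le_rayleigh_of_mem (hM t) K (K.smul_mem c hφK) hc1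
    rw [mulVec_smul, pgdfv_re_star_smul_dotProduct_smul, hray] at hle
    have h3 := mul_le_mul_of_nonneg_right ((hGD t).trans hle) hpos.le
    calc (e - X * t ^ 2) * (1 + t ^ 2 * (star w ⬝ᵥ w).re)
        ≤ ‖c‖ ^ 2 * (e + t ^ 2 * ((star w ⬝ᵥ (A *ᵥ w)).re - 2 * (star w ⬝ᵥ (B *ᵥ ψ)).re)) *
            (1 + t ^ 2 * (star w ⬝ᵥ w).re) := h3
      _ = e + t ^ 2 * ((star w ⬝ᵥ (A *ᵥ w)).re - 2 * (star w ⬝ᵥ (B *ᵥ ψ)).re) := by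
          linear_combination (e + t ^ 2 * ((star w ⬝ᵥ (A *ᵥ w)).re - 2 * (star w ⬝ᵥ (B *ᵥ ψ)).re)) * hc2
  have hend := pgdfv_real_endgame key
  linarith

end Abstract

/-! ## §2 Sector bookkeeping on the fermionic torus -/

section Sector

/-- Vectors of joint sectors `(a, S^z = M_a)`, `(b, S^z = M_b)` with `a ≠ b` are orthogonal
(different particle numbers). Tasaki (2020) §9.2. [folklore] -/
theorem pgdfv_star_dotProduct_eq_zero_of_mem_szSector {Λ : Type*} [LinearOrder Λ] [Fintype Λ]
    {a b : ℕ} {Ma Mb : ℝ} {u v : Fock (Orb Λ)} (hu : u ∈ szSector a Ma) (hv : v ∈ szSector b Mb)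
    (hab : a ≠ b) : star u ⬝ᵥ v = 0 :=
  ThermodynamicLimit.dotProduct_eq_zero_of_isNParticle_ne ((mem_szSector_iff a Ma u).1 hu).1
    ((mem_szSector_iff b Mb v).1 hv).1 hab

/-- `Re ⟨w, (H − μ N̂) w⟩ = Re ⟨w, H w⟩ − μ M ‖w‖²` for `w` in the joint sector `(M, S^z = S)`
(`N̂ w = M w`). Tasaki (2020) §9.2. [folklore] -/
theorem pgdfv_re_sub_smul_totalNumber {Λ : Type*} [LinearOrder Λ] [Fintype Λ]
    (H : Matrix (Finset (Orb Λ)) (Finset (Orb Λ)) ℂ) (μ : ℝ) {M : ℕ} {S : ℝ} {w : Fock (Orb Λ)}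
    (hw : w ∈ szSector M S) :
    (star w ⬝ᵥ ((H - (μ : ℂ) • (totalNumber : Matrix (Finset (Orb Λ)) (Finset (Orb Λ)) ℂ)) *ᵥ w)).re =
      (star w ⬝ᵥ (H *ᵥ w)).re - μ * (M : ℝ) * (star w ⬝ᵥ w).re := by
  have hN : IsNParticle M w := ((mem_szSector_iff M S w).1 hw).1
  rw [sub_mulVec, smul_mulVec, totalNumber_mulVec_of_isNParticle hN, smul_smul, dotProduct_sub,
    dotProduct_smul, smul_eq_mul, Complex.sub_re]
  have e1 : ((μ : ℂ) * (M : ℂ) * (star w ⬝ᵥ w)).re = μ * (M : ℝ) * (star w ⬝ᵥ w).re := by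
    rw [show ((μ : ℂ) * (M : ℂ)) = ((μ * (M : ℝ) : ℝ) : ℂ) by push_cast; ring, Complex.re_ofReal_mul]
  rw [e1]

variable {L : ℕ} [NeZero L]

/-- **The pair source has no diagonal matrix elements inside a particle-number sector**:
`⟨w, (Δ_g(m) + Δ_g(m)ᴴ) w⟩ = 0` for `w ∈ (M, S^z = S)`, because `Δ_g(m)ᴴ w ∈ (M + 2, S)` is
orthogonal to `w` and `⟨w, Δ_g(m) w⟩ = ⟨Δ_g(m)ᴴ w, w⟩`. Tasaki (2020) §9.3. [folklore] -/
theorem pgdfv_pairSource_diag_eq_zero (g : Site 2 → ℝ) (m : TorusSite 2 L) {M : ℕ} {S : ℝ}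
    {w : Fock (Orb (FermionTorus 2 L))} (hw : w ∈ szSector M S) :
    star w ⬝ᵥ ((pairFieldAt g L m + (pairFieldAt g L m)ᴴ) *ᵥ w) = 0 := by
  have hup := WcbcsSsbToTorusLRO.conjTranspose_pairFieldAt_mulVec_mem_szSector g m hw
  rw [add_mulVec, dotProduct_add, WcbcsSsbToTorusLRO.mc_star_dotProduct_mulVec_eq (pairFieldAt g L m) w w,
    pgdfv_star_dotProduct_eq_zero_of_mem_szSector hup hw (by omega),
    pgdfv_star_dotProduct_eq_zero_of_mem_szSector hw hup (by omega), add_zero]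

end Sector

/-! ## §3 The stub -/

/-- **Stub FV — `stub_pgdFirstVariation` (finite-dimensional).** The first-order variation of the energy
form: if the sourced, `μ`-shifted Hamiltonian `H − μN̂ − t(Δ + Δᴴ)` on `(N−2,0) ⊔ (N,0)` obeys the
quadratic lower bound `E(N) − μN − X t² ≤ minEnergyOn` of C⁺_λ for all real `t` (with
`2μ = E(N) − E(N−2) + λ`), then testing the Rayleigh quotient at `ψ + t•w`, `w ∈ (N−2,0)`, and letting
`t → 0` gives the regularised variational pair stiffness `2Re⟨w,Δψ⟩ − (Re⟨w,Hw⟩ − (E(N−2) − λ)‖w‖²) ≤ X`;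
and the twin on `(N,0) ⊔ (N+2,0)` with `Δᴴψ`, `2μ' = E(N+2) − E(N) − λ`. Cross terms vanish by
particle-number orthogonality; both halves are `pgdfv_firstVariation` with `A = H − μN̂`, `B = Δ + Δᴴ`,
`e = E(N) − μN`. Kennedy–Lieb–Shastry, PRL 61 (1988) 2582 (GD ⇒ susceptibility); first-order
perturbation theory. [folklore] -/
theorem stub_pgdFirstVariation :
    ∀ (L : ℕ) [NeZero L] (U : ℝ) (N : ℕ), 2 ≤ N → ∀ ψ : Fock (Orb (FermionTorus 2 L)), IsGroundStateInSector (hubbardTorus 2 L 1 U) N 0 ψ → star ψ ⬝ᵥ ψ = 1 → ∀ (m : TorusSite 2 L) (X lam : ℝ), ((∀ t : ℝ, (hubbardTorus 2 L 1 U).minEnergyOn (szSector N 0) - ((hubbardTorus 2 L 1 U).minEnergyOn (szSector N 0) - (hubbardTorus 2 L 1 U).minEnergyOn (szSector (N - 2) 0) + lam) / 2 * (N : ℝ) - X * t ^ 2 ≤ (hubbardTorus 2 L 1 U - ((((hubbardTorus 2 L 1 U).minEnergyOn (szSector N 0) - (hubbardTorus 2 L 1 U).minEnergyOn (szSector (N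 - 2) 0) + lam) / 2 : ℝ) : ℂ) • (totalNumber : Matrix (Finset (Orb (FermionTorus 2 L))) (Finset (Orb (FermionTorus 2 L))) ℂ) - (t : ℂ) • (pairFieldAt dWaveFormFactor L m + (pairFieldAt dWaveFormFactor L m)ᴴ)).minEnergyOn (szSector (N - 2) 0 ⊔ szSector N 0)) → ∀ w : Fock (Orb (FermionTorus 2 L)), w ∈ szSector (N - 2) 0 → 2 * (star w ⬝ᵥ (pairFieldAt dWaveFormFactor L m *ᵥ ψ)).re - ((star w ⬝ᵥ (hubbardTorus 2 L 1 U *ᵥ w)).re - ((hubbardTorus 2 L 1 U).minEnergyOn (szSector (N - 2) 0) - lam) * (star w ⬝ᵥ w).re) ≤ X) ∧ ((∀ t : ℝ, (hubbardTorus 2 L 1 U).minEnergyOn (szSector N 0) - ((hubbardTorus 2 L 1 U).minEnergyOn (szSector (N + 2) 0) - (hubbardTorus 2 L 1 U).minEnergyOn (szSector N 0) - lam) / 2 * (N : ℝ) - X * t ^ 2 ≤ (hubbardTorus 2 L 1 U - ((((hubbardTorus 2 L 1 U).minEnergyOn (szSector (N + 2) 0) - (hubbardTorus 2 L 1 U).minEnergyOn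 (szSector N 0) - lam) / 2 : ℝ) : ℂ) • (totalNumber : Matrix (Finset (Orb (FermionTorus 2 L))) (Finset (Orb (FermionTorus 2 L))) ℂ) - (t : ℂ) • (pairFieldAt dWaveFormFactor L m + (pairFieldAt dWaveFormFactor L m)ᴴ)).minEnergyOn (szSector N 0 ⊔ szSector (N + 2) 0)) → ∀ w : Fock (Orb (FermionTorus 2 L)), w ∈ szSector (N + 2) 0 → 2 * (star w ⬝ᵥ ((pairFieldAt dWaveFormFactor L m)ᴴ *ᵥ ψ)).re - ((star w ⬝ᵥ (hubbardTorus 2 L 1 U *ᵥ w)).re - ((hubbardTorus 2 L 1 U).minEnergyOn (szSector (N + 2) 0) - lam) * (star w ⬝ᵥ w).re) ≤ X) := by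
  intro L _ U N hN ψ hψ hψ1 m X lam
  -- abbreviations
  set H := hubbardTorus 2 L 1 U with hHdef
  set Δ := pairFieldAt dWaveFormFactor L m with hΔdef
  set Nhat : Matrix (Finset (Orb (FermionTorus 2 L))) (Finset (Orb (FermionTorus 2 L))) ℂ :=
    totalNumber with hNhat
  have hψK : ψ ∈ szSector N 0 := hψ.1
  have hHerm : H.IsHermitian := LiebThm1.hamiltonian_isHermitian (fermionTorusGraph 2 L) 1 U
  have hB : (Δ + Δᴴ).IsHermitian := isHermitian_add_transpose_self Δ
  have hψB : star ψ ⬝ᵥ ((Δ + Δᴴ) *ᵥ ψ) = 0 := pgdfv_pairSource_diag_eq_zero dWaveFormFactor m hψK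
  have hΔψ : Δ *ᵥ ψ ∈ szSector (N - 2) 0 :=
    WcbcsSsbToTorusLRO.pairFieldAt_mulVec_mem_szSector dWaveFormFactor m hN hψK
  have hΔHψ : Δᴴ *ᵥ ψ ∈ szSector (N + 2) 0 :=
    WcbcsSsbToTorusLRO.conjTranspose_pairFieldAt_mulVec_mem_szSector dWaveFormFactor m hψK
  refine ⟨fun hGD w hw => ?_, fun hGD w hw => ?_⟩
  · -- removal side: `K = (N−2,0) ⊔ (N,0)`, `2μ = E(N) − E(N−2) + λ`
    set μ : ℝ := (H.minEnergyOn (szSector N 0) - H.minEnergyOn (szSector (N - 2) 0) + lam) / 2 with hμ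
    have hA : (H - (μ : ℂ) • Nhat).IsHermitian := isHermitian_sub_smul_totalNumber hHerm μ
    have hAψ := sub_smul_totalNumber_mulVec_of_isGroundStateInSector hψ μ
    have horth : star ψ ⬝ᵥ w = 0 := pgdfv_star_dotProduct_eq_zero_of_mem_szSector hψK hw (by omega)
    have hwB : star w ⬝ᵥ ((Δ + Δᴴ) *ᵥ w) = 0 := pgdfv_pairSource_diag_eq_zero dWaveFormFactor m hw
    have hfv := pgdfv_firstVariation hA hB (szSector (N - 2) 0 ⊔ szSector N 0)
      (Submodule.mem_sup_right hψK) (Submodule.mem_sup_left hw) hψ1 hAψ horth hψB hwB hGD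
    -- unfold the source and the chemical potential
    have hsrc : star w ⬝ᵥ ((Δ + Δᴴ) *ᵥ ψ) = star w ⬝ᵥ (Δ *ᵥ ψ) := by
      rw [add_mulVec, dotProduct_add, pgdfv_star_dotProduct_eq_zero_of_mem_szSector hw hΔHψ (by omega),
        add_zero]
    rw [hsrc, pgdfv_re_sub_smul_totalNumber H μ hw, Nat.cast_sub hN, Nat.cast_ofNat, hμ] at hfv
    linarith
  · -- addition side: `K = (N,0) ⊔ (N+2,0)`, `2μ' = E(N+2) − E(N) − λ`
    set μ : ℝ := (H.minEnergyOn (szSector (N + 2) 0) - H.minEnergyOn (szSector N 0) - lam) / 2 with hμ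
    have hA : (H - (μ : ℂ) • Nhat).IsHermitian := isHermitian_sub_smul_totalNumber hHerm μ
    have hAψ := sub_smul_totalNumber_mulVec_of_isGroundStateInSector hψ μ
    have horth : star ψ ⬝ᵥ w = 0 := pgdfv_star_dotProduct_eq_zero_of_mem_szSector hψK hw (by omega)
    have hwB : star w ⬝ᵥ ((Δ + Δᴴ) *ᵥ w) = 0 := pgdfv_pairSource_diag_eq_zero dWaveFormFactor m hw
    have hfv := pgdfv_firstVariation hA hB (szSector N 0 ⊔ szSector (N + 2) 0)
      (Submodule.mem_sup_left hψK) (Submodule.mem_sup_right hw) hψ1 hAψ horth hψB hwB hGD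
    have hsrc : star w ⬝ᵥ ((Δ + Δᴴ) *ᵥ ψ) = star w ⬝ᵥ (Δᴴ *ᵥ ψ) := by
      rw [add_mulVec, dotProduct_add, pgdfv_star_dotProduct_eq_zero_of_mem_szSector hw hΔψ (by omega),
        zero_add]
    rw [hsrc, pgdfv_re_sub_smul_totalNumber H μ hw, Nat.cast_add, Nat.cast_ofNat, hμ] at hfv
    linarith

end Summit.HubbardSuperconductivity.HubbardSuperconductivity.Theorems.WindowInfraredBound
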